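import Literature.AlgebraicGeometry.CossartPiltant200819.GaloisApproximation2008
import Literature.AlgebraicGeometry.CossartPiltant200819.Cor46Cofinality2008
import Literature.AlgebraicGeometry.Resolution.KrullRamificationHenselSubfields
import Literature.AlgebraicGeometry.Resolution.ArithmeticalThreefoldsLocalEtaleClimb
import Literature.AlgebraicGeometry.Resolution.AbhyankarValuationsLocalUniformization
import HarnessLib

/-!
# Cossart–Piltant 2008, Corollary 6.3: climbing to a subfield of the inertia field

[CP-I] V. Cossart, O. Piltant, *Resolution of singularities of threefolds in positive
characteristic I*, J. Algebra 320 (2008) 1051–1082 (HAL hal-00139124), Cor. 6.3 (HAL p. 19):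

> Let `L/K` be a Galois extension of function fields of transcendence degree three over `k` and
> let `W/k` be a `k`-valuation ring such that `QF(W) = L`. Let `V := W ∩ K`. Let `K'`,
> `K ⊆ K' ⊆ L` be an intermediate extension such that `K'` is contained in `Kⁱ`, the inertia
> field of `W` over `V`. Let `V' := W ∩ K'`. If `V/k` has a local uniformization, then `V'/k`
> has a local uniformization.

This file DISCHARGES the named fact `CP2008.ClimbToInertiaField` (`Ramification2008.lean`)
from the leaf `CP2008.Cofinality` ([CP-I] Cor. 4.6, itself proved from CP 2019 principalization
in `Cor46Cofinality2008.lean`): `climbToInertiaField_of_cofinality`, hence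
`climbToInertiaField_of_principalization`.  (The earlier discharge
`Bridge2019.climbToInertiaField_of_cossartPiltant2019LU3` from the full relative LU theorem of
CP 2019 is not restated here; the present proof is the paper's: cofinality of local
uniformizations in `K` plus an étale climb.)

## The proof formalised

The printed proof (HAL p. 19) takes a normal local model `R₀` as in Prop. 6.2 (1), a local
uniformization `R ⊇ R₀` of `V` (Cor. 4.6), and concludes that the local ring `R'` of `K'` above
`R` dominated by `V'` is local-étale over `R` ([40] = Raynaud, *Anneaux locaux henséliens*,
Thm. 2 p. 110), hence regular. Mathlib has no local-étale algebras over normal local domains, so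
the étale climb is made EXPLICIT through a henselian generator, following Knaf–Kuhlmann
(*Every place admits local uniformization in a finite extension of the function field*,
Adv. Math. 221 (2009), Lemma 3.7): by `Resolution.exists_henselRoot_toSubfield_fixedField_eq`
(`KrullRamificationHenselSubfields.lean`, [KK09] Lemma 3.7 (3) for an arbitrary subgroup
`H ⊇ G_T`), `K' = K(η)` for some `η ∈ W` which is a root of a monic `F ∈ (W ∩ K)[X]` with
`F'(η) ∈ W^×`. Cofinality (Cor. 4.6) supplies a local uniformization `R = (A₁)_𝔭` of `V`
containing the coefficients of `F` (the model `R₀` of Prop. 6.2 (1) is replaced by any normal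
local model containing them, `exists_isNormalLocalModelOf_forall_mem`), and the one-link étale
climb `Resolution.exists_model_adjoin_of_henselRoot` (`ArithmeticalThreefoldsLocalEtaleClimb.lean`:
`A₁[η]` localised at the centre of `W` is standard-étale over `R`, hence regular, with fraction
field `K(η) = K'`) produces the local uniformization of `V'`. The transport between the paper's
frame (`K'` an intermediate field of `L/K`, models inside `K` and `K'`) and the tree's ambient
frame (`Ω := L`, `M := K ⊆ L` a subfield, models `k[t] ⊆ L`) is bookkeeping:
`autTopHom_surjective`, `mem_lift_fixedField_map_autTopHom_iff`,
`inertiaGroupIn_top_le_map_autTopHom`, and `Resolution.isLocallyUniformizable_comap_of_model`.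

[cite: CossartPiltant2008, Cor 6.3 (HAL p. 19)]
[cite: KnafKuhlmann2009, Lemma 3.7 (arXiv:math/0702856 p. 13)]
-/

noncomputable section

open Polynomial IsLocalRing IntermediateField
open scoped Pointwise IntermediateField

namespace Literature.AlgebraicGeometry.CossartPiltant200819.CP2008

open Literature.AlgebraicGeometry.Resolution

universe u

section TopFrame

variable {K L : Type u} [Field K] [Field L] [Algebra K L]

/-- `autTopHom : Gal(L/K) → Aut(⊤ / K-range)` is surjective (hence bijective, with
`autTopHom_injective`): an automorphism of `⊤ : IntermediateField (K-range) L` over the image of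
`K` is a `K`-automorphism of `L`. [folklore] -/
theorem autTopHom_surjective : Function.Surjective (autTopHom (K := K) (L := L)) := by
  intro τ
  let σ : L ≃ₐ[K] L :=
    { toFun := fun x => (τ ⟨x, IntermediateField.mem_top⟩ : L)
      invFun := fun x => (τ.symm ⟨x, IntermediateField.mem_top⟩ : L)
      left_inv := fun x => by
        change (τ.symm ⟨(τ ⟨x, mem_top⟩ : L), mem_top⟩ : L) = x
        rw [Subtype.coe_eta, τ.symm_apply_apply]
      right_inv := fun x => by
        change (τ ⟨(τ.symm ⟨x, mem_top⟩ : L), mem_top⟩ : L) = x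
        rw [Subtype.coe_eta, τ.apply_symm_apply]
      map_mul' := fun x y => by
        have h : (⟨x * y, mem_top⟩ : (⊤ : IntermediateField (baseSubfield K L) L)) =
            ⟨x, mem_top⟩ * ⟨y, mem_top⟩ := rfl
        change (τ ⟨x * y, mem_top⟩ : L) = τ ⟨x, mem_top⟩ * τ ⟨y, mem_top⟩
        rw [h, map_mul]
        rfl
      map_add' := fun x y => by
        have h : (⟨x + y, mem_top⟩ : (⊤ : IntermediateField (baseSubfield K L) L)) =
            ⟨x, mem_top⟩ + ⟨y, mem_top⟩ := rfl
        change (τ ⟨x + y, mem_top⟩ : L) = τ ⟨x, mem_top⟩ + τ ⟨y, mem_top⟩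
        rw [h, map_add]
        rfl
      commutes' := fun c => by
        have hc : (⟨algebraMap K L c, mem_top⟩ : (⊤ : IntermediateField (baseSubfield K L) L)) =
            algebraMap (baseSubfield K L) (⊤ : IntermediateField (baseSubfield K L) L)
              ⟨algebraMap K L c, RingHom.mem_fieldRange.mpr ⟨c, rfl⟩⟩ := Subtype.ext rfl
        change (τ ⟨algebraMap K L c, mem_top⟩ : L) = algebraMap K L c
        rw [hc, τ.commutes]
        rfl }
  exact ⟨σ, by ext x; rfl⟩

/-- **Frame transport for intermediate fields.** For `L/K` finite Galois and `K'` an intermediate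
field, the lift to `L` of the fixed field (inside `⊤ / K-range`) of the image of `Gal(L/K')` under
`autTopHom` is `K'` again. [folklore] -/
theorem mem_lift_fixedField_map_autTopHom_iff [FiniteDimensional K L] [IsGalois K L]
    (K' : IntermediateField K L) (x : L) :
    x ∈ IntermediateField.lift (fixedField ((K'.fixingSubgroup).map
      (autTopHom (K := K) (L := L)))) ↔ x ∈ K' := by
  have h1 : x ∈ IntermediateField.lift (fixedField ((K'.fixingSubgroup).map
      (autTopHom (K := K) (L := L)))) ↔
      (⟨x, mem_top⟩ : (⊤ : IntermediateField (baseSubfield K L) L)) ∈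
        fixedField ((K'.fixingSubgroup).map (autTopHom (K := K) (L := L))) :=
    IntermediateField.mem_lift (⟨x, mem_top⟩ : (⊤ : IntermediateField (baseSubfield K L) L))
  rw [h1, IntermediateField.mem_fixedField_iff]
  constructor
  · intro h
    rw [← IsGalois.fixedField_fixingSubgroup K', IntermediateField.mem_fixedField_iff]
    intro σ hσ
    exact congrArg (fun y : (⊤ : IntermediateField (baseSubfield K L) L) => (y : L))
      (h (autTopHom σ) (Subgroup.mem_map_of_mem _ hσ))
  · intro h τ hτ
    obtain ⟨σ, hσ, rfl⟩ := Subgroup.mem_map.mp hτ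
    apply Subtype.ext
    change σ x = x
    rw [IntermediateField.mem_fixingSubgroup_iff] at hσ
    exact hσ x h

/-- **(31) of the source in the ambient frame**: if `K' ⊆ Kⁱ` (`LeInertiaField`), then
Zariski–Samuel's inertia group `G_T` of `W` (ambient `Ω := L`, top field `⊤`) is contained in the
image of `Gal(L/K')`. [cite: CossartPiltant2008, Cor 6.3 proof, (31) (HAL p. 19)] -/
theorem inertiaGroupIn_top_le_map_autTopHom (W : ValuationSubring L) (K' : IntermediateField K L)
    (hK' : LeInertiaField K W K') :
    inertiaGroupIn W (⊤ : IntermediateField (baseSubfield K L) L) ≤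
      (K'.fixingSubgroup).map (autTopHom (K := K) (L := L)) := by
  intro τ hτ
  obtain ⟨σ, rfl⟩ := autTopHom_surjective τ
  refine Subgroup.mem_map_of_mem _ ?_
  rw [IntermediateField.mem_fixingSubgroup_iff]
  exact hK' σ ((mem_inertiaGroup_iff W σ).mp ((autTopHom_mem_inertiaGroupIn_iff W σ).mp hτ))

end TopFrame

section Cor63

/-- **[CP-I] Cor. 6.3 from Cor. 4.6 — the named fact `ClimbToInertiaField` DISCHARGED modulo
the leaf `Cofinality`.** For `K/k` finitely generated of transcendence degree three, `L/K` finite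
Galois, `W ⊇ k` a valuation ring of `L` and `K ⊆ K' ⊆ Kⁱ(W | W ∩ K)`: if `W ∩ K` is locally
uniformizable over `k`, so is `W ∩ K'`. Proof: `K' = K(η)` with `η ∈ W` henselian over `W ∩ K`
(`Resolution.exists_henselRoot_toSubfield_fixedField_eq`, [KK09] Lemma 3.7 (3)); a local
uniformization `(A₁)_𝔭` of `W ∩ K` whose local ring contains the coefficients of the henselian
minimal equation (cofinality, Cor. 4.6, over a normal local model containing them); the étale
climb `Resolution.exists_model_adjoin_of_henselRoot` (replacing [40] Thm. 2 p. 110); transport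
back to `K'` (`Resolution.isLocallyUniformizable_comap_of_model`).
[cite: CossartPiltant2008, Cor 6.3 (HAL p. 19)]
[cite: KnafKuhlmann2009, Lemma 3.7 (arXiv:math/0702856 p. 13)] -/
theorem climbToInertiaField_of_cofinality (hcof : Cofinality.{u}) : ClimbToInertiaField.{u} := by
  intro k K _ _ _ hfg h3 L _ _ _ _ hfin hgal W hk K' hK' hLU
  classical
  haveI := hfin
  haveI := hgal
  -- the ambient frame `Ω := L`, `M := K ⊆ L`, `N := ⊤`
  letI : Algebra K (baseSubfield K L) := (algebraMap K L).rangeRestrictField.toAlgebra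
  haveI : IsScalarTower K (baseSubfield K L) L := IsScalarTower.of_algebraMap_eq fun x => rfl
  haveI : FiniteDimensional (baseSubfield K L) L :=
    Module.Finite.of_restrictScalars_finite K (baseSubfield K L) L
  haveI : IsGalois (baseSubfield K L) L := IsGalois.tower_top_of_isGalois K (baseSubfield K L) L
  haveI : FiniteDimensional (baseSubfield K L) (⊤ : IntermediateField (baseSubfield K L) L) :=
    LinearEquiv.finiteDimensional
      (IntermediateField.topEquiv (F := baseSubfield K L) (E := L)).symm.toLinearEquiv
  haveI : IsGalois (baseSubfield K L) (⊤ : IntermediateField (baseSubfield K L) L) :=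
    IsGalois.of_algEquiv (IntermediateField.topEquiv (F := baseSubfield K L) (E := L)).symm
  -- Step 0: `K' = K(η)` for a henselian element `η` over `W ∩ K`
  have hH : inertiaGroupIn W (⊤ : IntermediateField (baseSubfield K L) L) ≤
      (K'.fixingSubgroup).map (autTopHom (K := K) (L := L)) :=
    inertiaGroupIn_top_le_map_autTopHom W K' hK'
  obtain ⟨η, hηW, -, ⟨F, hFmon, hFcoeff, hFη, hF'⟩, hfield⟩ :=
    exists_henselRoot_toSubfield_fixedField_eq W (⊤ : IntermediateField (baseSubfield K L) L)
      ((K'.fixingSubgroup).map (autTopHom (K := K) (L := L))) hH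
  have hK'eq : K'.toSubfield =
      (IntermediateField.adjoin (baseSubfield K L) ({η} : Set L)).toSubfield := by
    rw [← hfield]
    ext x
    exact (mem_lift_fixedField_map_autTopHom_iff K' x).symm
  -- Step 1: a local uniformization of `W ∩ K` containing the coefficients of `F` (Cor. 4.6)
  let O : ValuationSubring K := W.comap (algebraMap K L)
  have hkO : ∀ c : k, algebraMap k K c ∈ O := fun c => by
    change algebraMap K L (algebraMap k K c) ∈ W
    rw [← IsScalarTower.algebraMap_apply]
    exact hk c
  have hpre : ∀ i, ∃ c : K, algebraMap K L c = F.coeff i := fun i =>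
    RingHom.mem_fieldRange.mp (hFcoeff i).2
  choose c hc using hpre
  let Fc : Finset K := (Finset.range (F.natDegree + 1)).image c
  have hFcO : ∀ x ∈ Fc, x ∈ O := by
    intro x hx
    obtain ⟨i, -, rfl⟩ := Finset.mem_image.mp hx
    change algebraMap K L (c i) ∈ W
    rw [hc]
    exact (hFcoeff i).1
  obtain ⟨R₀, hR₀, hFcR₀⟩ := exists_isNormalLocalModelOf_forall_mem hfg O hkO Fc hFcO
  obtain ⟨R₁, ⟨⟨A₁, hA₁fg, hA₁fr, hA₁O, hR₁⟩, hR₁reg⟩, hR₀R₁⟩ :=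
    hcof k K hfg h3 O hkO hLU R₀ hR₀.isLocalModelOf
  haveI := hA₁fr
  -- regularity of `A₁` at the centre of `O`, from the regularity of `R₁ = (A₁)_𝔭 ⊆ K`
  have hregK : IsRegularLocalRing (Localization.AtPrime
      (Ideal.comap (Subring.inclusion hA₁O) (maximalIdeal O))) := by
    haveI : IsFractionRing A₁.toSubring K := isFractionRing_toSubring A₁
    obtain ⟨e⟩ := nonempty_ringEquiv_localization_centre O A₁.toSubring hA₁O R₁.toSubring hR₁
    haveI : IsRegularLocalRing R₁.toSubring :=
      @IsRegularLocalRing.of_ringEquiv R₁ _ hR₁reg _ _ (subalgebraRingEquivToSubring R₁)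
    exact IsRegularLocalRing.of_ringEquiv e.symm
  -- Step 2: the image model `k[t₁] = A₁ ⊆ K ⊆ L`
  obtain ⟨s₁, hs₁⟩ := hA₁fg
  let f : K →ₐ[k] L := IsScalarTower.toAlgHom k K L
  let t₁ : Finset L := s₁.image (algebraMap K L)
  have hT₁ : Algebra.adjoin k (t₁ : Set L) = A₁.map f := by
    change Algebra.adjoin k ((s₁.image (algebraMap K L) : Finset L) : Set L) = _
    rw [Finset.coe_image, ← hs₁, AlgHom.map_adjoin]
    rfl
  have hmemT₁ : ∀ {a : K}, a ∈ A₁ → algebraMap K L a ∈ Algebra.adjoin k (t₁ : Set L) :=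
    fun {a} ha => by
    rw [hT₁]
    exact Subalgebra.mem_map.mpr ⟨a, ha, rfl⟩
  have hT₁sub : ∀ {y : L}, y ∈ Algebra.adjoin k (t₁ : Set L) → ∃ a ∈ A₁, algebraMap K L a = y :=
    fun {y} hy => by
    rw [hT₁] at hy
    obtain ⟨a, ha, rfl⟩ := Subalgebra.mem_map.mp hy
    exact ⟨a, ha, rfl⟩
  have ht₁M : (t₁ : Set L) ⊆ baseSubfield K L := by
    intro y hy
    obtain ⟨x, -, rfl⟩ := Finset.mem_image.mp (Finset.mem_coe.mp hy)
    exact RingHom.mem_fieldRange.mpr ⟨x, rfl⟩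
  have hcl : ∀ {a : K}, a ∈ A₁ →
      algebraMap K L a ∈ Subfield.closure (Set.range (algebraMap k L) ∪ (t₁ : Set L)) :=
    fun {a} ha => by
    have h1 := hmemT₁ ha
    rw [← Subalgebra.mem_toSubring, Algebra.adjoin_eq_ring_closure] at h1
    exact Subfield.subring_closure_le _ h1
  have hMcl : baseSubfield K L ≤ Subfield.closure (Set.range (algebraMap k L) ∪ (t₁ : Set L)) := by
    intro y hy
    obtain ⟨z, rfl⟩ := RingHom.mem_fieldRange.mp hy
    obtain ⟨a, b, -, hab⟩ := IsFractionRing.div_surjective (A := A₁) z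
    rw [← hab, map_div₀]
    exact div_mem (hcl a.2) (hcl b.2)
  have hTO₁ : (Algebra.adjoin k (t₁ : Set L)).toSubring ≤ W.toSubring := by
    intro y hy
    obtain ⟨a, ha, rfl⟩ := hT₁sub hy
    exact hA₁O ha
  have hmapS : A₁.toSubring.map (algebraMap K L) = (Algebra.adjoin k (t₁ : Set L)).toSubring := by
    ext y
    simp only [Subring.mem_map, Subalgebra.mem_toSubring]
    constructor
    · rintro ⟨a, ha, rfl⟩
      exact hmemT₁ ha
    · intro hy
      obtain ⟨a, ha, rfl⟩ := hT₁sub hy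
      exact ⟨a, ha, rfl⟩
  have hreg₁ : IsRegularLocalRing (Localization.AtPrime
      (Ideal.comap (Subring.inclusion hTO₁) (maximalIdeal W))) := by
    let e : A₁.toSubring ≃+* (Algebra.adjoin k (t₁ : Set L)).toSubring :=
      (A₁.toSubring.equivMapOfInjective (algebraMap K L) (algebraMap K L).injective).trans
        (RingEquiv.subringCongr hmapS)
    have he : ∀ a : A₁.toSubring,
        ((e a : (Algebra.adjoin k (t₁ : Set L)).toSubring) : L) = algebraMap K L a := fun a => rfl
    set P : Ideal (Algebra.adjoin k (t₁ : Set L)).toSubring :=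
      Ideal.comap (Subring.inclusion hTO₁) (maximalIdeal W) with hP
    haveI hPp : P.IsPrime := Ideal.comap_isPrime _ _
    have hPe : P.comap (e : A₁.toSubring →+* (Algebra.adjoin k (t₁ : Set L)).toSubring) =
        Ideal.comap (Subring.inclusion hA₁O) (maximalIdeal O) := by
      ext a
      have h2 : Subring.inclusion hTO₁ (e a) = ⟨algebraMap K L a, hTO₁ (e a).2⟩ :=
        Subtype.ext (he a)
      simp only [Ideal.mem_comap, hP, RingHom.coe_coe]
      rw [h2]
      exact (mk_mem_maximalIdeal_comap_iff W (algebraMap K L) (hA₁O a.2)).symm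
    haveI : (P.comap (e : A₁.toSubring →+* (Algebra.adjoin k (t₁ : Set L)).toSubring)).IsPrime :=
      Ideal.comap_isPrime _ _
    exact (isRegularLocalRing_localization_iff_of_ringEquiv e P).mpr
      (isRegularLocalRing_localization_atPrime_congr hPe.symm hregK)
  -- the coefficients of `F` lie in the local ring of the image model
  have hcoef : ∀ i, ∃ a s : L, a ∈ Algebra.adjoin k (t₁ : Set L) ∧
      s ∈ Algebra.adjoin k (t₁ : Set L) ∧ W.valuation s = 1 ∧ F.coeff i * s = a := by
    intro i
    by_cases hi : i < F.natDegree + 1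
    · have hci : c i ∈ (R₁ : Set K) :=
        hR₀R₁ (hFcR₀ _ (Finset.mem_image.mpr ⟨i, Finset.mem_range.mpr hi, rfl⟩))
      rw [hR₁] at hci
      obtain ⟨a, ha, s, hs, hvs, hcas⟩ := hci
      have hs0 : s ≠ 0 := by
        rintro rfl
        simp at hvs
      refine ⟨algebraMap K L a, algebraMap K L s, hmemT₁ ha, hmemT₁ hs,
        (valuation_comap_eq_one_iff W s).mp hvs, ?_⟩
      rw [← hc i, hcas, ← map_mul, inv_mul_cancel_right₀ hs0]
    · refine ⟨0, 1, Subalgebra.zero_mem _, Subalgebra.one_mem _, by simp, ?_⟩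
      rw [Polynomial.coeff_eq_zero_of_natDegree_lt (by omega), zero_mul]
  -- Step 3: the étale climb to `K' = K(η)` inside `L`
  obtain ⟨t', ht'K, hK'cl, hTO', hreg'⟩ :=
    exists_model_adjoin_of_henselRoot (S := k) W (baseSubfield K L) t₁ ht₁M hMcl hTO₁ hreg₁ η hηW
      F hFmon hFη hF' hcoef
  rw [← hK'eq] at ht'K hK'cl
  -- Step 4: back to the field `K'`
  haveI : IsScalarTower k K' L := IsScalarTower.of_algebraMap_eq fun c => by
    rw [IsScalarTower.algebraMap_apply k K K' c, ← IsScalarTower.algebraMap_apply K K' L,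
      ← IsScalarTower.algebraMap_apply k K L]
  have hle : Algebra.adjoin k (t' : Set L) ≤ (K'.restrictScalars k).toSubalgebra :=
    Algebra.adjoin_le fun y hy => ht'K hy
  have hAK : ∀ x ∈ Algebra.adjoin k (t' : Set L),
      x ∈ Set.range (IsScalarTower.toAlgHom k K' L) := fun x hx => ⟨⟨x, hle hx⟩, rfl⟩
  have hfrac : ∀ z : K', ∃ a b : L, a ∈ Algebra.adjoin k (t' : Set L) ∧
      b ∈ Algebra.adjoin k (t' : Set L) ∧ b ≠ 0 ∧ IsScalarTower.toAlgHom k K' L z = a / b := by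
    intro z
    have hz : (z : L) ∈ Subfield.closure (Set.range (algebraMap k L) ∪ (t' : Set L)) :=
      hK'cl z.2
    rw [Subfield.mem_closure_iff] at hz
    obtain ⟨a, ha, b, hb, hab⟩ := hz
    rw [← Algebra.adjoin_eq_ring_closure] at ha hb
    by_cases hb0 : b = 0
    · refine ⟨0, 1, Subalgebra.zero_mem _, Subalgebra.one_mem _, one_ne_zero, ?_⟩
      rw [div_one]
      change (z : L) = 0
      rw [← hab, hb0, div_zero]
    · exact ⟨a, b, ha, hb, hb0, hab.symm⟩
  exact isLocallyUniformizable_comap_of_model (IsScalarTower.toAlgHom k K' L) W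
    (Algebra.adjoin k (t' : Set L)) hTO' hAK (Subalgebra.fg_adjoin_finset _) hfrac hreg'

/-- **[CP-I] Cor. 6.3 from CP 2019 principalization** (through `cofinality_of_principalization`).
[cite: CossartPiltant2008, Cor 6.3 (HAL p. 19)]
[cite: CossartPiltant2019, Prop. 4.4 (arXiv v1: Prop. 4.3)] -/
theorem climbToInertiaField_of_principalization (hP : CossartPiltant2019Principalization.{u}) :
    ClimbToInertiaField.{u} :=
  climbToInertiaField_of_cofinality (cofinality_of_principalization hP)

end Cor63

end Literature.AlgebraicGeometry.CossartPiltant200819.CP2008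

end
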